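import Summits.Ventures.DiscreteObjects.Hadamard.AutomorphismTransfer668

/-!
# Hadamard matrices with a permutation automorphism pair of prime order: the orbit-sum ('Hadamard form of the orbit matrix') identity (kernel, general)

Framing: lottery ticket; floor = certified bounds/negative ranges.

Cell pub-namedobj (venture DiscreteObjects), target (H), hadamard gen 7 (FAMILY-F12-G7 §2).  Let `H` be a Hadamard matrix of
order `n` (`H Hᵀ = n I`, entries `±1`) and `(π, κ)` a pair of permutations with `H (π i) (κ j) = H i j`, `π ^ p = κ ^ p = 1`,
`p` prime.  For a row `i` and a column `j` put
* `ocs i j := ∑_{i' ∈ orbit(i)} H i' j`  (orbit–column sum; `orbit = orbFin π p`, a singleton for a fixed row, `p` rows otherwise),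
* `bsum i j := ∑_{i' ∈ orbit(i)} ∑_{j' ∈ orbit(j)} H i' j'`  (block sum of the orbit matrix).
Then (no invariance needed) `∑_j ocs i j * ocs i' j = n · |orbit(i) ∩ orbit(i')|` (`ocs_mul_sum`); with invariance `ocs i` is
constant along `κ`-orbits (`ocs_perm`), so `bsum i j = |orbit(j)| · ocs i j` and the **weighted orbit-sum identity**
`∑_j w j * bsum i j * bsum i' j = p² · n · |orbit(i) ∩ orbit(i')|` holds with `w j = p²` for a `κ`-fixed column and `w j = 1`
otherwise (`orbitSum_identity`).  Dividing by `p²` resp. reading it orbit by orbit, this is exactly `Θ Θᵀ = n·I` for the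
orbit-sum matrix `Θ = [[A, √p B],[√p C, F]]` of FAMILY-F12-G7 §2 (rows/columns = orbits, `A` = sums over orbit×orbit blocks
divided by `p`, `B, C, F` the entries against fixed columns/rows).  Pure permutation pairs only; the reduction of a signed
automorphism of odd order to a permutation pair (re-signing along cycles) is not formalised here.  Ours, not literature; no `sorry`.
-/

open Finset BigOperators Matrix

namespace Summit.Ventures.DiscreteObjects.Hadamard

open Literature.Combinatorics.Designs.GoethalsSeidel (IsHadamardMatrix)

variable {ι : Type*} [Fintype ι] [DecidableEq ι]

omit [Fintype ι] in
/-- the orbit of a fixed point is the singleton -/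
lemma orbFin_of_fixed (σ : Equiv.Perm ι) {p : ℕ} (hp : 0 < p) {a : ι} (ha : σ a = a) : orbFin σ p a = {a} := by
  ext b
  unfold orbFin
  rw [Finset.mem_image, Finset.mem_singleton]
  constructor
  · rintro ⟨i, -, rfl⟩
    exact perm_pow_apply_of_fixed σ ha i
  · intro hb
    exact ⟨0, Finset.mem_range.mpr hp, by rw [hb, pow_zero, Equiv.Perm.one_apply]⟩

omit [Fintype ι] in
/-- the orbit is `σ`-stable: `(orbFin σ p a).image σ = orbFin σ p a` -/
lemma image_orbFin (σ : Equiv.Perm ι) {p : ℕ} (hp : p.Prime) (hσ : σ ^ p = 1) (a : ι) :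
    (orbFin σ p a).image σ = orbFin σ p a := by
  by_cases ha : σ a = a
  · rw [orbFin_of_fixed σ hp.pos ha, Finset.image_singleton, ha]
  · have := image_pow_orbFin σ hp hσ ha 1
    rwa [pow_one] at this

section sums
variable (H : Matrix ι ι ℤ) (π κ : Equiv.Perm ι) (p : ℕ)

/-- orbit–column sum: the sum of column `j` of `H` over the `π`-orbit of the row `i` -/
def ocs (i j : ι) : ℤ := ∑ i' ∈ orbFin π p i, H i' j

/-- block sum of the orbit matrix: `H` summed over (orbit of `i`) × (orbit of `j`) -/
def bsum (i j : ι) : ℤ := ∑ i' ∈ orbFin π p i, ∑ j' ∈ orbFin κ p j, H i' j'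

omit [DecidableEq ι] in
/-- rows of a Hadamard matrix: `∑_j H a j H b j = n [a = b]` -/
lemma hadamard_rows [DecidableEq ι] (hH : IsHadamardMatrix H) (a b : ι) :
    ∑ j, H a j * H b j = if a = b then (Fintype.card ι : ℤ) else 0 := by
  by_cases hab : a = b
  · subst hab; rw [if_pos rfl]; exact hadamard_row_self H hH a
  · rw [if_neg hab]; exact hadamard_row_orth H hH hab

/-- **`∑_j ocs i j * ocs i' j = n · |orbit(i) ∩ orbit(i')|`** — bilinearity and `H Hᵀ = n I` only. -/
theorem ocs_mul_sum (hH : IsHadamardMatrix H) (i i' : ι) :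
    ∑ j, ocs H π p i j * ocs H π p i' j =
      (Fintype.card ι : ℤ) * ((orbFin π p i ∩ orbFin π p i').card : ℤ) := by
  unfold ocs
  calc ∑ j, (∑ a ∈ orbFin π p i, H a j) * (∑ b ∈ orbFin π p i', H b j)
      = ∑ j, ∑ a ∈ orbFin π p i, ∑ b ∈ orbFin π p i', H a j * H b j := by
        apply Finset.sum_congr rfl; intro j _; rw [Finset.sum_mul_sum]
    _ = ∑ a ∈ orbFin π p i, ∑ b ∈ orbFin π p i', ∑ j, H a j * H b j := by
        rw [Finset.sum_comm]; apply Finset.sum_congr rfl; intro a _; rw [Finset.sum_comm]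
    _ = ∑ a ∈ orbFin π p i, ∑ b ∈ orbFin π p i', (if a = b then (Fintype.card ι : ℤ) else 0) := by
        apply Finset.sum_congr rfl; intro a _; apply Finset.sum_congr rfl; intro b _
        exact hadamard_rows H hH a b
    _ = ∑ a ∈ orbFin π p i, (if a ∈ orbFin π p i' then (Fintype.card ι : ℤ) else 0) := by
        apply Finset.sum_congr rfl; intro a _
        rw [Finset.sum_ite_eq]
    _ = (Fintype.card ι : ℤ) * ((orbFin π p i ∩ orbFin π p i').card : ℤ) := by
        rw [← Finset.sum_filter, Finset.filter_mem_eq_inter, Finset.sum_const, nsmul_eq_mul, mul_comm]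

omit [Fintype ι] in
/-- with invariance, the orbit–column sum is unchanged under `κ`: `ocs i (κ j) = ocs i j` -/
theorem ocs_perm (hinv : ∀ i j, H (π i) (κ j) = H i j) (hp : p.Prime) (hπ : π ^ p = 1) (i j : ι) :
    ocs H π p i (κ j) = ocs H π p i j := by
  unfold ocs
  calc ∑ a ∈ orbFin π p i, H a (κ j)
      = ∑ a ∈ (orbFin π p i).image π, H a (κ j) := by rw [image_orbFin π hp hπ i]
    _ = ∑ a ∈ orbFin π p i, H (π a) (κ j) := Finset.sum_image (fun a _ b _ h => π.injective h)
    _ = ∑ a ∈ orbFin π p i, H a j := by apply Finset.sum_congr rfl; intro a _; exact hinv a j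

omit [Fintype ι] in
/-- hence constant along `κ`-orbits: `ocs i ((κ^k) j) = ocs i j` -/
lemma ocs_perm_pow (hinv : ∀ i j, H (π i) (κ j) = H i j) (hp : p.Prime) (hπ : π ^ p = 1) (i j : ι) (k : ℕ) :
    ocs H π p i ((κ ^ k) j) = ocs H π p i j := by
  induction k generalizing j with
  | zero => simp
  | succ k ih => rw [pow_succ', Equiv.Perm.mul_apply, ocs_perm H π κ p hinv hp hπ, ih]

omit [Fintype ι] in
/-- block sum = orbit length × orbit–column sum -/
lemma bsum_eq (hinv : ∀ i j, H (π i) (κ j) = H i j) (hp : p.Prime) (hπ : π ^ p = 1) (i j : ι) :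
    bsum H π κ p i j = ((orbFin κ p j).card : ℤ) * ocs H π p i j := by
  unfold bsum
  rw [Finset.sum_comm]
  have : ∀ j' ∈ orbFin κ p j, ∑ i' ∈ orbFin π p i, H i' j' = ocs H π p i j := by
    intro j' hj'
    obtain ⟨k, -, rfl⟩ := Finset.mem_image.mp hj'
    exact ocs_perm_pow H π κ p hinv hp hπ i j k
  rw [Finset.sum_congr rfl this, Finset.sum_const, nsmul_eq_mul]

/-- **Weighted orbit-sum identity** (`Θ Θᵀ = n·I` in integers): for a Hadamard matrix `H` of order `n` with a permutation
automorphism pair `(π, κ)`, `π^p = κ^p = 1`, `p` prime, and any rows `i, i'`: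
`∑_j w j · bsum i j · bsum i' j = p² · n · |orbit(i) ∩ orbit(i')|`, `w j = p²` if `κ j = j` and `1` otherwise. -/
theorem orbitSum_identity (hH : IsHadamardMatrix H) (hinv : ∀ i j, H (π i) (κ j) = H i j)
    (hp : p.Prime) (hπ : π ^ p = 1) (hκ : κ ^ p = 1) (i i' : ι) :
    ∑ j, (if κ j = j then ((p : ℤ) ^ 2) else 1) * bsum H π κ p i j * bsum H π κ p i' j =
      (p : ℤ) ^ 2 * (Fintype.card ι : ℤ) * ((orbFin π p i ∩ orbFin π p i').card : ℤ) := by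
  have key : ∀ j, (if κ j = j then ((p : ℤ) ^ 2) else 1) * bsum H π κ p i j * bsum H π κ p i' j =
      (p : ℤ) ^ 2 * (ocs H π p i j * ocs H π p i' j) := by
    intro j
    rw [bsum_eq H π κ p hinv hp hπ i j, bsum_eq H π κ p hinv hp hπ i' j]
    by_cases hj : κ j = j
    · rw [if_pos hj, orbFin_of_fixed κ hp.pos hj, Finset.card_singleton]; push_cast; ring
    · rw [if_neg hj, card_orbFin κ hp hκ hj]; ring
  rw [Finset.sum_congr rfl (fun j _ => key j), ← Finset.mul_sum, ocs_mul_sum H π p hH i i']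
  ring

omit [Fintype ι] in
/-- the same identity read on the entries against a FIXED column `j` (`bsum i j = ocs i j`, weight `p²`) and a moved column
(`bsum i j = p · ocs i j`, weight `1`) — the `√p` scaling of `Θ`. -/
theorem bsum_fixed_col (hinv : ∀ i j, H (π i) (κ j) = H i j) (hp : p.Prime) (hπ : π ^ p = 1) {i j : ι} (hj : κ j = j) :
    bsum H π κ p i j = ocs H π p i j := by
  rw [bsum_eq H π κ p hinv hp hπ i j, orbFin_of_fixed κ hp.pos hj, Finset.card_singleton]; simp

omit [Fintype ι] in
/-- against a moved column `j` (`κ j ≠ j`): `bsum i j = p · ocs i j` -/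
theorem bsum_moved_col (hinv : ∀ i j, H (π i) (κ j) = H i j) (hp : p.Prime) (hπ : π ^ p = 1) (hκ : κ ^ p = 1)
    {i j : ι} (hj : κ j ≠ j) : bsum H π κ p i j = (p : ℤ) * ocs H π p i j := by
  rw [bsum_eq H π κ p hinv hp hπ i j, card_orbFin κ hp hκ hj]

end sums

end Summit.Ventures.DiscreteObjects.Hadamard
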